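import Literature.Geometry.Lorentzian.InitialDataPullback
import Literature.Geometry.Lorentzian.Genericity
import HarnessLib

/-!
# Pullback of smooth families of initial data along local diffeomorphisms

Topic `Literature/Geometry/Lorentzian`. Everything here is PROVED; no definition, no statement of
`Prop` type is introduced.

`InitialDataPullback.lean` pulls back ONE initial data set `D = (h, k)` along an equidimensional
immersion `Φ : N → M` (`InitialDataSet.comap`; Bartnik–Isenberg 2004, §2: the constraint map is
diffeomorphism-equivariant) and proves that the pullback of a `C^n` section of the bundle of
bilinear forms is `C^n` (`PseudoRiemannianMetric.contMDiff_pullbackBilin_section`). Here the same is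
done for FAMILIES: a smooth `m`-parameter family of data `F : ℝᵐ → InitialDataSet I M`
(`InitialDataSet.IsSmoothDataFamily`, `Genericity.lean`: the two section maps `(c, x) ↦ h_c(x)`,
`(c, x) ↦ k_c(x)` are `C^∞` on `ℝᵐ × M`) pulls back to a smooth family `c ↦ Φ^*(F c)` on `N`.
This is the reading of smooth data families in a chart (`Φ` = an inverse chart, `N` = the chart
target, an open subset of the model space), the first step of every coordinate computation with
the witness families of the named fact `ChruscielDelay_localConstraintDeformation`
(`LocalConstraintDeformation.lean`; its witness hypothesis is an `IsSmoothDataFamily 1` on the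
`3`-manifold `X`, while the coordinate linearised constraint map of
`DataFamilyTangentKernel.lean` lives on `E3`).

* `PseudoRiemannianMetric.contMDiff_pullbackBilin_family` — **the pullback along a `C^{n+1}` map
  `f : N → M` of a family of sections of the bilinear-form bundle of `M`, jointly `C^n` on
  `P × M` (`P` any parameter manifold), is jointly `C^n` on `P × N`** (the proof of
  `contMDiff_pullbackBilin_section` with the parameter carried along: in tangent coordinates
  `f^* s_p = (Df)ᵀ (s_p ∘ f) (Df)`);
* `InitialDataSet.IsSmoothDataFamily.comap` — **the pulled-back family `c ↦ Φ^*(F c)` of a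
  smooth family of data is a smooth family.**

## References

* R. Bartnik, J. Isenberg, *The constraint equations* (2004), §2. [BartnikIsenberg2004]
* B. O'Neill, *Semi-Riemannian geometry* (1983), Ch. 3, Def. 3.9, Lemma 3.35. [ONeill1983]
-/

noncomputable section

open Bundle Set Function Filter Manifold VectorField FiberBundle
open scoped Manifold ContDiff Topology

namespace Literature.Geometry.Lorentzian

variable {E : Type*} [NormedAddCommGroup E] [NormedSpace ℝ E] {H : Type*} [TopologicalSpace H]
  {I : ModelWithCorners ℝ E H} {M : Type*} [TopologicalSpace M] [ChartedSpace H M]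
  {E' : Type*} [NormedAddCommGroup E'] [NormedSpace ℝ E'] {H' : Type*} [TopologicalSpace H']
  {I' : ModelWithCorners ℝ E' H'} {N : Type*} [TopologicalSpace N] [ChartedSpace H' N]
  {EP : Type*} [NormedAddCommGroup EP] [NormedSpace ℝ EP] {HP : Type*} [TopologicalSpace HP]
  {IP : ModelWithCorners ℝ EP HP} {P : Type*} [TopologicalSpace P] [ChartedSpace HP P]

/-! ### Pullback of a jointly smooth family of sections of the bilinear-form bundle -/

namespace PseudoRiemannianMetric

/-- **The pullback of a jointly `C^n` family of sections of the bundle of bilinear forms on `TM`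
along a `C^{n+1}` map `f : N → M` is a jointly `C^n` family of sections** of the bundle of bilinear
forms on `TN` (parameter manifold `P`; the sections are maps `P × M → Hom(TM, Hom(TM, ℝ))` over
`(p, x) ↦ x`). In tangent coordinates around `y₀` and `f y₀`,
`f^* s_p = (Φ)ᵀ (β_p ∘ f) Φ` with `Φ = Df` read in charts (`inTangentCoordinates`, `C^n` by
`ContMDiffAt.mfderiv_const`) and `β_p = s_p` read in charts, jointly `C^n` by the criterion
`contMDiffAt_bilin_iff`. O'Neill 1983, Ch. 3, Def. 3.9 and Lemma 3.35 ff.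
[cite: ONeill1983, Ch. 3, Def. 3.9 and Lemma 3.35] -/
theorem contMDiff_pullbackBilin_family [IsManifold I' ∞ N] [IsManifold I ∞ M] {n : ℕ∞ω}
    {f : N → M} (hf : ContMDiff I' I (n + 1) f)
    {s : P → Π x : M, TangentSpace I x →L[ℝ] TangentSpace I x →L[ℝ] ℝ}
    (hs : ContMDiff (IP.prod I) (I.prod 𝓘(ℝ, E →L[ℝ] E →L[ℝ] ℝ)) n
      (fun q : P × M ↦ TotalSpace.mk' (E →L[ℝ] E →L[ℝ] ℝ)
        (E := fun x : M ↦ TangentSpace I x →L[ℝ] TangentSpace I x →L[ℝ] ℝ) q.2 (s q.1 q.2))) :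
    ContMDiff (IP.prod I') (I'.prod 𝓘(ℝ, E' →L[ℝ] E' →L[ℝ] ℝ)) n
      (fun q : P × N ↦ TotalSpace.mk' (E' →L[ℝ] E' →L[ℝ] ℝ)
        (E := fun y : N ↦ TangentSpace I' y →L[ℝ] TangentSpace I' y →L[ℝ] ℝ) q.2
        (pullbackBilin (I := I) (I' := I') f (s q.1) q.2)) := by
  intro q₀
  rw [contMDiffAt_bilin_iff]
  refine ⟨contMDiffAt_snd, ?_⟩
  set τN := trivializationAt E' (TangentSpace I' : N → Type _) q₀.2 with hτN
  set τM := trivializationAt E (TangentSpace I : M → Type _) (f q₀.2) with hτM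
  set Φ : N → E' →L[ℝ] E := inTangentCoordinates I' I id f (fun y ↦ mfderiv I' I f y) q₀.2 with hΦ
  have hΦs : ContMDiffAt I' 𝓘(ℝ, E' →L[ℝ] E) n Φ q₀.2 :=
    ContMDiffAt.mfderiv_const (hf q₀.2) le_rfl
  have hΦs' : ContMDiffAt (IP.prod I') 𝓘(ℝ, E' →L[ℝ] E) n (fun q : P × N ↦ Φ q.2) q₀ :=
    hΦs.comp q₀ contMDiffAt_snd
  set β : P × M → E →L[ℝ] E →L[ℝ] ℝ := fun q ↦
    (ContinuousLinearMap.precomp ℝ (τM.symmL ℝ q.2)).comp ((s q.1 q.2).comp (τM.symmL ℝ q.2))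
    with hβ
  have hβs : ContMDiffAt (IP.prod I) 𝓘(ℝ, E →L[ℝ] E →L[ℝ] ℝ) n β (q₀.1, f q₀.2) :=
    ((contMDiffAt_bilin_iff (IX := IP.prod I) (IB := I) (V := (TangentSpace I : M → Type _))
      (b := Prod.snd) (s := fun q : P × M ↦ s q.1 q.2) (x₀ := (q₀.1, f q₀.2))).1
      (hs (q₀.1, f q₀.2))).2
  have hf' : ContMDiffAt I' I n f q₀.2 := (hf q₀.2).of_le le_self_add
  have hι : ContMDiffAt (IP.prod I') (IP.prod I) n (fun q : P × N ↦ (q.1, f q.2)) q₀ :=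
    contMDiffAt_fst.prodMk (hf'.comp q₀ contMDiffAt_snd)
  have hβf : ContMDiffAt (IP.prod I') 𝓘(ℝ, E →L[ℝ] E →L[ℝ] ℝ) n (fun q : P × N ↦ β (q.1, f q.2)) q₀ :=
    ContMDiffAt.comp q₀ hβs hι
  have h1 : ContMDiffAt (IP.prod I') 𝓘(ℝ, E' →L[ℝ] E →L[ℝ] ℝ) n
      (fun q : P × N ↦ (β (q.1, f q.2)).comp (Φ q.2)) q₀ :=
    ContMDiffAt.clm_comp hβf hΦs'
  have h2 : ContMDiffAt (IP.prod I') 𝓘(ℝ, (E →L[ℝ] ℝ) →L[ℝ] (E' →L[ℝ] ℝ)) n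
      (fun q : P × N ↦ (Φ q.2).precomp ℝ) q₀ :=
    hΦs'.clm_precomp (F₃ := ℝ)
  have hcomp : ContMDiffAt (IP.prod I') 𝓘(ℝ, E' →L[ℝ] E' →L[ℝ] ℝ) n
      (fun q : P × N ↦ ((Φ q.2).precomp ℝ).comp ((β (q.1, f q.2)).comp (Φ q.2))) q₀ :=
    ContMDiffAt.clm_comp h2 h1
  refine hcomp.congr_of_eventuallyEq ?_
  have hev : ∀ᶠ q : P × N in 𝓝 q₀, f q.2 ∈ τM.baseSet :=
    ((hf q₀.2).continuousAt.comp continuousAt_snd).preimage_mem_nhds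
      (τM.open_baseSet.mem_nhds (FiberBundle.mem_baseSet_trivializationAt' (f q₀.2)))
  filter_upwards [hev] with q hfq
  ext e e'
  have key : ∀ v : E', τM.symmL ℝ (f q.2) (Φ q.2 v) = mfderiv I' I f q.2 (τN.symmL ℝ q.2 v) := by
    intro v
    simp only [hΦ, inTangentCoordinates, ContinuousLinearMap.inCoordinates,
      ContinuousLinearMap.coe_comp, comp_apply, id_eq]
    exact τM.symmL_continuousLinearMapAt hfq _
  simp only [ContinuousLinearMap.coe_comp, comp_apply, ContinuousLinearMap.precomp_apply,
    pullbackBilin_apply, hβ, key]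
  rfl

end PseudoRiemannianMetric

/-! ### Pullback of a smooth family of data -/

namespace InitialDataSet

variable [IsManifold I ∞ M] [IsManifold I' ∞ N] [FiniteDimensional ℝ E']

/-- **The pullback of a smooth family of initial data along an equidimensional immersion is a
smooth family**: if `F : ℝᵐ → InitialDataSet I M` is a smooth `m`-parameter family
(`IsSmoothDataFamily`) and `Φ : N → M` a smooth map with injective differentials, then
`c ↦ Φ^*(F c)` (`InitialDataSet.comap`) is a smooth `m`-parameter family of data on `N` (both
section maps are pullbacks of jointly smooth families of sections,
`contMDiff_pullbackBilin_family`). Bartnik–Isenberg 2004, §2. [cite: BartnikIsenberg2004, §2] -/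
theorem IsSmoothDataFamily.comap {m : ℕ} {F : EuclideanSpace ℝ (Fin m) → InitialDataSet I M}
    (hF : IsSmoothDataFamily m F) {Φ : N → M} (hΦ : ContMDiff I' I (∞ + 1) Φ)
    (hΦ' : ∀ u, Function.Injective (mfderiv I' I Φ u)) :
    IsSmoothDataFamily m (fun c ↦ (F c).comap Φ hΦ hΦ') :=
  ⟨PseudoRiemannianMetric.contMDiff_pullbackBilin_family (s := fun c x ↦ (F c).h.inner x) hΦ hF.1,
    PseudoRiemannianMetric.contMDiff_pullbackBilin_family (s := fun c x ↦ (F c).k x) hΦ hF.2⟩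

end InitialDataSet

end Literature.Geometry.Lorentzian

end
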